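import Literature.NumberTheory.Rogawski1990.ArchBouazizStableFamilyCayleyValue     -- ★ p850153 ∕ p850211 (LH5-p04 (g2)): (I₂@cayPt) closed form, `…_of_continuousAt`, `…_ne_zero_of_prod`
import Literature.NumberTheory.Automorphic.ArchEndoscopicChartOrbPlaces            -- ★ p850200 (LH3-p03 (g3)): (P1) `chartOrbH_eq_prod_chartOrbHLoc`
import Literature.NumberTheory.Automorphic.ArchEndoscopicChartOrbLocalPos          -- ★ p850271 ∕ p850286 (LH5-p04 (g2)): (N2) local positivity
import Literature.NumberTheory.Automorphic.ArchEndoscopicStableClassFlips          -- ★ p849928 (LH2-p04 (g3)): `endoCircle_flipSet`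
import HarnessLib

/-!
# Non-vanishing of the Cayley-point value of `stOrbFamH` for a product test function with non-negative local factors — (β)-2 (N3) «NONDEG-H, assembly»
# (Shelstad 1979 §4 Lemma 4.3, Thm. 4.7 (IIIb); Bouaziz 1994 §3.2 (I₃); Rogawski 1990 §8.2)

Topic `NumberTheory/Rogawski1990`; namespace `Literature.NumberTheory.Rogawski1990`.  THEOREMS ONLY (no definition, no instance, no notation, no axiom, no named fact,
no `sorry`).  Cell `pub/hodgecm-mathlib`, line LH3 (closer stub `stub_N9`, crux H413 = `stmt-HodgeConjecture-24833`); brick **(β)-2 (N3)** of LH3-plan (g3)'s RULINGS #4 (a)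
(2026-09-02T07:40:37Z): the NON-VANISHING conjunct of the hypothesis (JH) of the organ-J assembler, for the SAME product test function the jump theorem (J-H) reads.
Author LH5-p04 (g2).  Lane `--kind proof --supports stmt-HodgeConjecture-24833` (count-neutral).

THE STATEMENT.  Frame: the product-measure convention of ★ (P1) (`νH = (eA⁻¹_* ⊗_w ν_w) ⊗ ν_B`, Haar measures), a compact place `w₀ ∉ S`, a semiregular wall point `s`
(`s w₀ 0 = s w₀ 2`, regular at the other places), the split chart `S′ = insert w₀ S`.  PRODUCT DATA (the output of (N1) «arch product test functions», LH2-p04 (g3), taken as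
HYPOTHESES so that every consumer reads the same `fH`): real local factors `f w ≥ 0` on `U(Φ₂)_w`, continuous, positive AT the chart point
`endoBlockAt S′ w (s w)` of every spectator place `w ≠ w₀`; a real `g` on `U(Φ₁)_∞`, continuous, non-zero at the `U(Φ₁)`-component of the Cayley chart point; and
`fH (a, b) = (∏_w f w (eA a w)) · g b` (cast to `ℂ`).  ANALYTIC INPUTS BY STATEMENT (named bricks of the LH3 board): at the spectators, compact support of the orbital integrand at
the regular chart point (closed orbit) and continuity of the local chart functional ★ `chartOrbHLoc` there ((CONT-loc)); at `w₀`, the (A0) limit `ℓ₀` of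
`|e^{x}−e^{−x}| · chartOrbHLoc S′ w₀ ν_{w₀} (f w₀) (x, ·, θ)` along the local regular set at the wall triple (★ p850218 joint ∘ (DOCK-w₀)) and `ℓ₀ ≠ 0` (★ N2b cone positivity ∘
(DOCK-w₀)).  CONCLUSION: **`stOrbFamH L νH fH (insert w₀ S) (cayPt w₀ s) ≠ 0`**, indeed `= g₀ · ∏_w ℓ w` with every factor an explicit non-zero number.

PROOF = ★ `stOrbFamH_insert_cayPt_eq_mul_prod_of_continuousAt` (closed form) with `G c = ν_B(B) · g((endoTorus S′ c).2)` (flip-invariant: the flips do not touch slot 1 —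
★ `endoCircle_flipSet`; continuous: ★ `continuous_endoTorus`) and `φ w = chartOrbHLoc S′ w ν_w (f w)` (★ (P1)), then factor by factor: `g₀ ≠ 0` (`ν_B(B) > 0`, `g ≠ 0`), split spectator
★ `absExpSub_mul_chartOrbHLoc_ofReal_ne_zero_of_nonneg`, compact spectator ★ `compactFactor_chartOrbHLoc_ofReal_ne_zero_of_nonneg`, wall place `ℓ₀ ≠ 0`.
HONEST LABEL: HC_CM is proved only modulo the 7 printed citations (2 remaining: hLiu418 = stmt-HodgeConjecture-24832, h413 = stmt-HodgeConjecture-24833) until rung 0 closes;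
assembly bookkeeping, pays nothing by itself.

## References
* [Shelstad1979] D. Shelstad, *Characters and inner forms of a quasi-split group over ℝ*, Compositio Math. 39 (1979) 11–45, §4 Lemma 4.3 p. 25, Thm. 4.7 (IIIb) p. 31.
* [Bouaziz1994IntegralesOrbitales] A. Bouaziz, *Intégrales orbitales sur les groupes de Lie réductifs*, Ann. Sci. ÉNS 27 (1994) 573–609, §3.2 (I₃) p. 580, §6.2 p. 591.
* [Rogawski1990] J. D. Rogawski, *Automorphic Representations of Unitary Groups in Three Variables*, Ann. of Math. Stud. 123 (1990), §8.2 pp. 118–124.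
-/

set_option autoImplicit false

noncomputable section

open Filter Topology MeasureTheory MeasureTheory.Measure NumberField NumberField.InfinitePlace Complex Set Function Real
open Literature.MeasureTheory.Group
open Literature.NumberTheory.Automorphic Literature.NumberTheory.Automorphic.UnitaryGroup Literature.NumberTheory.Automorphic.ArchCartan
open scoped Classical

namespace Literature.NumberTheory.Rogawski1990

/-! ## §1 The `U(Φ₁)`-component of the chart ignores the flips (over ★ `endoCircle_flipSet`) -/

section Circle

variable (L : Type) [Field L]

variable [NumberField L] [IsCMField L]

/-- The `U(Φ₁)`-component of `endoTorus S c` is flip-invariant. [cite: Shelstad1979, §4 p. 23] -/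
theorem endoTorus_flipSet_snd (S T : Finset {w : InfinitePlace L // IsComplex w}) (c : {w : InfinitePlace L // IsComplex w} → Fin 3 → ℝ) :
    (endoTorus L S (flipSet T c)).2 = (endoTorus L S c).2 := by
  unfold endoTorus
  rw [endoCircle_flipSet]

end Circle

/-! ## §2 (N3): the Cayley-point value of `stOrbFamH` of a non-negative product test function does not vanish -/

section Nondeg

variable (L : Type) [Field L] [NumberField L] [IsCMField L]
  [∀ w : {w : InfinitePlace L // IsComplex w}, MeasurableSpace ↥(archLocal L 2 (Matrix.of fun i j : Fin 2 => if i.val + j.val + 1 = 2 then (1 : L) else 0) w)]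
  [∀ w : {w : InfinitePlace L // IsComplex w}, BorelSpace ↥(archLocal L 2 (Matrix.of fun i j : Fin 2 => if i.val + j.val + 1 = 2 then (1 : L) else 0) w)]
  [MeasurableSpace ↥(arch (↥(maximalRealSubfield L)) L (IsCMField.complexConj L) 2 (Matrix.of fun i j : Fin 2 => if i.val + j.val + 1 = 2 then (1 : L) else 0))]
  [BorelSpace ↥(arch (↥(maximalRealSubfield L)) L (IsCMField.complexConj L) 2 (Matrix.of fun i j : Fin 2 => if i.val + j.val + 1 = 2 then (1 : L) else 0))]
  [MeasurableSpace ↥(arch (↥(maximalRealSubfield L)) L (IsCMField.complexConj L) 1 (Matrix.of fun i j : Fin 1 => if i.val + j.val + 1 = 1 then (1 : L) else 0))]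
  [BorelSpace ↥(arch (↥(maximalRealSubfield L)) L (IsCMField.complexConj L) 1 (Matrix.of fun i j : Fin 1 => if i.val + j.val + 1 = 1 then (1 : L) else 0))]
  (νw : ∀ w : {w : InfinitePlace L // IsComplex w}, Measure ↥(archLocal L 2 (Matrix.of fun i j : Fin 2 => if i.val + j.val + 1 = 2 then (1 : L) else 0) w))
  [∀ w, (νw w).IsHaarMeasure] [∀ w, (νw w).IsMulRightInvariant]
  (νB : Measure ↥(arch (↥(maximalRealSubfield L)) L (IsCMField.complexConj L) 1 (Matrix.of fun i j : Fin 1 => if i.val + j.val + 1 = 1 then (1 : L) else 0)))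
  [νB.IsHaarMeasure] [νB.IsMulRightInvariant]
  (νH : Measure (↥(arch (↥(maximalRealSubfield L)) L (IsCMField.complexConj L) 2 (Matrix.of fun i j : Fin 2 => if i.val + j.val + 1 = 2 then (1 : L) else 0)) ×
      ↥(arch (↥(maximalRealSubfield L)) L (IsCMField.complexConj L) 1 (Matrix.of fun i j : Fin 1 => if i.val + j.val + 1 = 1 then (1 : L) else 0))))
  [νH.IsHaarMeasure] [νH.IsMulRightInvariant]
  (hν : νH = ((Measure.pi νw).map (archPiEquivCM 2 L (Matrix.of fun i j : Fin 2 => if i.val + j.val + 1 = 2 then (1 : L) else 0)).symm).prod νB)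

include hν in
/-- **(N3) «NONDEG-H»: THE CAYLEY-POINT VALUE OF THE STABLE ORBITAL FAMILY OF A NON-NEGATIVE PRODUCT TEST FUNCTION, POSITIVE AT THE CHART POINTS, DOES NOT VANISH.**
Product data `fH (a, b) = (∏_w f w (eA a w)) · g b` with real `f w ≥ 0` continuous, `f w (endoBlockAt S′ w (s w)) ≠ 0` at every spectator `w ≠ w₀`, real continuous `g` with
`g ((endoTorus S′ (cayPt w₀ s)).2) ≠ 0` ((N1)'s output at `a₀ w := endoBlockAt S′ w (s w)`, `b₀ :=` the Cayley point's `U(Φ₁)`-component); spectator inputs BY STATEMENT: compact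
support of the orbital integrands at the regular chart points (`hsupp`) and continuity of ★ `chartOrbHLoc S′ w` at the regular local triples (`hcontS`, `hcontC` — (CONT-loc)); wall input
BY STATEMENT: the (A0) limit `ℓ₀` of the Weyl-normalised local functional at `w₀` along the local regular set at the wall triple (★ p850218 ∘ (DOCK-w₀)) with `ℓ₀ ≠ 0` (★ N2b).
THEN `stOrbFamH L νH fH (insert w₀ S) (cayPt w₀ s) ≠ 0` — the value organ J divides the (K0±) jump by.
[cite: Shelstad1979, Lemma 4.3 (p. 25); Thm. 4.7 (IIIb) (p. 31)] [cite: Bouaziz1994IntegralesOrbitales, §3.2 (I₃) p. 580] [cite: Rogawski1990, §8.2 p. 122] -/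
theorem stOrbFamH_insert_cayPt_ne_zero_of_prodData
    (S : Finset {w : InfinitePlace L // IsComplex w}) {w₀ : {w : InfinitePlace L // IsComplex w}} (hw₀ : w₀ ∉ S)
    {s : {w : InfinitePlace L // IsComplex w} → Fin 3 → ℝ} (hs : s w₀ 0 = s w₀ 2)
    (hreg : ∀ w, w ∉ S → w ≠ w₀ → Circle.exp (s w 0) ≠ Circle.exp (s w 2)) (hregS : ∀ w ∈ S, s w 0 ≠ 0)
    -- the product data ((N1)'s output, as hypotheses)
    (fH : ↥(arch (↥(maximalRealSubfield L)) L (IsCMField.complexConj L) 2 (Matrix.of fun i j : Fin 2 => if i.val + j.val + 1 = 2 then (1 : L) else 0)) ×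
      ↥(arch (↥(maximalRealSubfield L)) L (IsCMField.complexConj L) 1 (Matrix.of fun i j : Fin 1 => if i.val + j.val + 1 = 1 then (1 : L) else 0)) → ℂ)
    (f : ∀ w : {w : InfinitePlace L // IsComplex w}, ↥(archLocal L 2 (Matrix.of fun i j : Fin 2 => if i.val + j.val + 1 = 2 then (1 : L) else 0) w) → ℝ)
    (g : ↥(arch (↥(maximalRealSubfield L)) L (IsCMField.complexConj L) 1 (Matrix.of fun i j : Fin 1 => if i.val + j.val + 1 = 1 then (1 : L) else 0)) → ℝ)
    (hfH : ∀ a b, fH (a, b) = (∏ w, ((f w (archPiEquivCM 2 L (Matrix.of fun i j : Fin 2 => if i.val + j.val + 1 = 2 then (1 : L) else 0) a w) : ℝ) : ℂ)) * ((g b : ℝ) : ℂ))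
    (hfc : ∀ w, Continuous (f w)) (hf0 : ∀ w, 0 ≤ f w)
    (hfpos : ∀ w, w ≠ w₀ → f w (endoBlockAt L (insert w₀ S) w (s w)) ≠ 0)
    (hgc : Continuous g) (hgpos : g (endoTorus L (insert w₀ S) (cayPt w₀ s)).2 ≠ 0) (hB : 0 < νB.real Set.univ)
    -- spectator inputs by statement: closed orbits and (CONT-loc)
    (hsupp : ∀ w, w ≠ w₀ → HasCompactSupport (descConj (endoBlockAt L (insert w₀ S) w (s w)) (chartTorusHLoc L (insert w₀ S) w)
      (forall_mem_chartTorusHLoc_comm L (insert w₀ S) w (s w)) (f w)))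
    (hcontS : ∀ w ∈ S, ContinuousAt (chartOrbHLoc L (insert w₀ S) w (νw w) (fun x => ((f w x : ℝ) : ℂ))) (s w))
    (hcontC : ∀ w, w ∉ S → w ≠ w₀ → ContinuousAt (chartOrbHLoc L (insert w₀ S) w (νw w) (fun x => ((f w x : ℝ) : ℂ))) (s w) ∧
      ContinuousAt (chartOrbHLoc L (insert w₀ S) w (νw w) (fun x => ((f w x : ℝ) : ℂ))) ![s w 2, s w 1, s w 0])
    -- the wall place by statement: the (A0) limit and its non-vanishing
    {ℓ₀ : ℂ}
    (hA0 : Tendsto (fun v : Fin 3 → ℝ => (((|Real.exp (v 0) - Real.exp (-v 0)| : ℝ) : ℂ) *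
        chartOrbHLoc L (insert w₀ S) w₀ (νw w₀) (fun x => ((f w₀ x : ℝ) : ℂ)) v)) (𝓝[{v : Fin 3 → ℝ | v 0 ≠ 0}] ![0, s w₀ 1, s w₀ 0]) (𝓝 ℓ₀))
    (hℓ₀ : ℓ₀ ≠ 0) :
    stOrbFamH L νH fH (insert w₀ S) (cayPt w₀ s) ≠ 0 := by
  -- the prefactor `G` and the local functionals `φ` of the product reading (★ (P1))
  have hP1 : ∀ c ∈ RegS (insert w₀ S), chartOrbH L νH (insert w₀ S) fH c =
      (fun c => (νB.real Set.univ : ℂ) * ((g (endoTorus L (insert w₀ S) c).2 : ℝ) : ℂ)) c *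
        ∏ w, (fun w v => chartOrbHLoc L (insert w₀ S) w (νw w) (fun x => ((f w x : ℝ) : ℂ)) v) w (c w) := by
    intro c _
    exact chartOrbH_eq_prod_chartOrbHLoc L (insert w₀ S) νw νB νH hν fH (fun w x => ((f w x : ℝ) : ℂ)) (fun b => ((g b : ℝ) : ℂ)) hfH c
  have hG : ∀ T : Finset {w : InfinitePlace L // IsComplex w}, (∀ w ∈ T, w ∉ insert w₀ S) → ∀ c,
      (fun c => (νB.real Set.univ : ℂ) * ((g (endoTorus L (insert w₀ S) c).2 : ℝ) : ℂ)) (flipSet T c) =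
        (fun c => (νB.real Set.univ : ℂ) * ((g (endoTorus L (insert w₀ S) c).2 : ℝ) : ℂ)) c := by
    intro T _ c
    simp only [endoTorus_flipSet_snd]
  have hGc : Continuous fun c : {w : InfinitePlace L // IsComplex w} → Fin 3 → ℝ => (νB.real Set.univ : ℂ) * ((g (endoTorus L (insert w₀ S) c).2 : ℝ) : ℂ) :=
    continuous_const.mul (Complex.continuous_ofReal.comp (hgc.comp (continuous_snd.comp (continuous_endoTorus L (insert w₀ S)))))
  have hGt : Tendsto (fun c : {w : InfinitePlace L // IsComplex w} → Fin 3 → ℝ => (νB.real Set.univ : ℂ) * ((g (endoTorus L (insert w₀ S) c).2 : ℝ) : ℂ))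
      (𝓝[RegS (insert w₀ S)] (cayPt w₀ s)) (𝓝 ((νB.real Set.univ : ℂ) * ((g (endoTorus L (insert w₀ S) (cayPt w₀ s)).2 : ℝ) : ℂ))) :=
    hGc.continuousAt.continuousWithinAt.tendsto
  rw [stOrbFamH_insert_cayPt_eq_mul_prod_of_continuousAt L νH fH S hw₀ hs hreg hregS hP1 hG hGt hA0 hcontS hcontC]
  refine mul_ne_zero (mul_ne_zero ?_ ?_) (Finset.prod_ne_zero_iff.2 fun w _ => ?_)
  · rw [Complex.ofReal_ne_zero]
    exact hB.ne'
  · rw [Complex.ofReal_ne_zero]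
    exact hgpos
  · by_cases hw : w = w₀
    · subst hw
      simpa only [if_true] using hℓ₀
    · simp only [if_neg hw]
      by_cases hwS : w ∈ S
      · rw [if_pos hwS]
        refine absExpSub_mul_chartOrbHLoc_ofReal_ne_zero_of_nonneg L (insert w₀ S) w (νw w) (s w) (hregS w hwS) (hfc w) (hf0 w) (hsupp w hw)
          (x₀ := 1) ?_
        simpa only [one_mul, inv_one, mul_one] using hfpos w hw
      · rw [if_neg hwS]
        refine compactFactor_chartOrbHLoc_ofReal_ne_zero_of_nonneg L (insert w₀ S) w (νw w) (s w) (hreg w hwS hw) (hfc w) (hf0 w) (hsupp w hw)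
          (x₀ := 1) ?_
        simpa only [one_mul, inv_one, mul_one] using hfpos w hw

end Nondeg

end Literature.NumberTheory.Rogawski1990

end
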